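import Literature.Barriers.BirchSwinnertonDyer.PAdicFunctionalEquationParity
import Literature.NumberTheory.EllipticCurves.PAdicLFunctionMultiplicativeFunctionalEquationProofs
import Literature.NumberTheory.EllipticCurves.AtkinLehnerInvolutionsNewformProofs
import Literature.NumberTheory.EllipticCurves.PAdicLFunctionInvolutionProofs
import HarnessLib

/-!
# Route `PrintX11a` (cell `bsd-print-x11a`, seat p3 — the Mazur–Tate–Teitelbaum road): the λ-PARITY LAW
# at an ODD multiplicative prime — `(−1)^λ = σ`, the `p`-adic sign of the functional equation
# (`--supports stmt-BirchSwinnertonDyer-20614 --as helper`; theorems only, no named fact, no definition)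

The odd-`p` companion of the tree's PARITY(2) files
(`Literature/Barriers/…/PAdicFunctionalEquationParityLambdaTwoMultProofs.lean`: at `p = 2` the functional
equation fixes `λ mod 2` through the SECOND fixed point `−2` of `ι`, and the sign drops out). At an ODD
prime the involution `ι(T) = (1+T)⁻¹ − 1` of the open unit disc has the single fixed point `0`, and the
functional equation of THE Mazur–Tate–Teitelbaum function at `p ‖ N`
(`IsSplitMultPAdicLFunctionOf.subst_eq_of_atkinLehner` / `IsMultPAdicLFunctionOf.subst_eq_of_atkinLehner`,
MTT 1986 §I.17: `L(ι T) = σ·(1+T)^c·L(T)`, `w_M f = −σ f`, `⟨M⟩ = γ^c`, `N = pM`) fixes the PARITY OF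
`λ` BY THE SIGN: reading the coefficient of `T^n` MODULO `p`, `n` the index of the first unit
coefficient of a multiple `t·L` (= `λ(L)` for `t = p^{−μ}`; only `g_0,…,g_n` enter), gives
`(−1)^n·g_n ≡ σ·g_n (mod p)` with `g_n` a unit, hence **`(−1)^n = σ`** since `p` is odd
(`neg_one_pow_firstUnitCoeff_eq_of_subst_invOnePlusSubOne_eq`, the formal shadow of "the roots of the
distinguished polynomial pair off under `ι` except at `T = 0`", MTT §I.18 / Greenberg LNM 1716 §5).

For the newform of an elliptic curve `σ = −ε_M = −a_p·w_E`; so in analytic rank `0` (`w_E = +1`):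
**`λ` is ODD at a split and EVEN at a non-split multiplicative prime** — lit g6's «λ-PARITY LAW at the
page» (DOSSIER §30.3: MTT §I.17 Cor. 2, §I.18 Prop.; 24/24 LMFDB rows, 7/7 REF OMS values), used by the
cell as a SAMPLING FILTER for μ-witness records (a level-`n` Teichmüller-coset witness needs
`λ < p^{n−1}`; with `ord_p 𝓛_p ≥ 1` at a non-surjective split pair, REF R4-1, `λ ≥ 3` there). Here it
is stated with the Atkin–Lehner sign `σ` as the explicit datum (as in the functional-equation theorems;
the translation `σ = −a_p·w_E` is `BSDRootNumberProofs` business). Nothing about any curve is booked;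
the class-wide children U5/U3 are untouched. beyond-print theorem: no (MTT §I.17–18, assembled).

* §1 `norm_coeff_mul_le_one`, `norm_coeff_invOnePlusSubOne_pow_le_one` — coefficient bookkeeping
  (`ι^d` has integer coefficients) at any prime;
* §2 `neg_one_pow_firstUnitCoeff_eq_of_subst_invOnePlusSubOne_eq` — the core, `p ≠ 2`;
* §3 `neg_one_pow_firstUnitCoeff_eq_sign_of_isSplitMultPAdicLFunctionOf` /
  `…_of_isMultPAdicLFunctionOf_neg_one` — for THE function of an elliptic curve at an odd `p ‖ N`.

References: [MazurTateTeitelbaum1986Invent] §I.17 (functional equation at p ∣ N, ⟨M⟩), §I.18;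
[GreenbergLNM1716] §1 pp. 67–68, §5 p. 181; [Knapp1993] Thm. 9.27(b) (Atkin–Lehner eigenvalues);
HOME/DOSSIER.md §30.3 (lit g6 L30), HOME/REF-AUDIT.md §F (R4-1).
-/

set_option autoImplicit false

noncomputable section

open scoped MatrixGroups ModularForm

open CongruenceSubgroup PowerSeries WeierstrassCurve
  Literature.NumberTheory.EllipticCurves Literature.NumberTheory.EllipticCurves.ModularForms
  Literature.Barriers.BirchSwinnertonDyer

namespace Summit.BirchSwinnertonDyer.Rank1Residual.X11a.LambdaParity

variable {p : ℕ} [Fact p.Prime]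

/-! ### §1 Coefficient bookkeeping at any prime -/

/-- A product of two series with `p`-integral coefficients has `p`-integral coefficients
(`ℚ_p` is ultrametric). [folklore] -/
theorem norm_coeff_mul_le_one {A B : ℚ_[p]⟦X⟧} (hA : ∀ k, ‖coeff k A‖ ≤ 1)
    (hB : ∀ k, ‖coeff k B‖ ≤ 1) (k : ℕ) : ‖coeff k (A * B)‖ ≤ 1 := by
  rw [coeff_mul]
  refine IsUltrametricDist.norm_sum_le_of_forall_le_of_nonneg zero_le_one fun ij _ ↦ ?_
  rw [norm_mul]
  calc ‖coeff ij.1 A‖ * ‖coeff ij.2 B‖ ≤ 1 * 1 :=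
        mul_le_mul (hA _) (hB _) (norm_nonneg _) zero_le_one
    _ = 1 := one_mul 1

/-- The coefficients of every power `ι^d` of `ι = −T + T² − ⋯` have norm `≤ 1` (they are integers).
[cite: GreenbergLNM1716, §1 (functional equation)] -/
theorem norm_coeff_invOnePlusSubOne_pow_le_one (d k : ℕ) :
    ‖coeff k ((invOnePlusSubOne : ℚ_[p]⟦X⟧) ^ d)‖ ≤ 1 := by
  induction d generalizing k with
  | zero =>
    rw [pow_zero, coeff_one]
    split_ifs <;> simp
  | succ d ih =>
    rw [pow_succ]
    refine norm_coeff_mul_le_one ih (fun j ↦ ?_) k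
    rw [coeff_invOnePlusSubOne]
    split_ifs <;> simp

/-! ### §2 The core: at an odd prime the functional equation fixes `(−1)^n`, `n` the first unit coefficient -/

/-- **The functional equation fixes the parity of the first unit coefficient (odd `p`).** Let
`g ∈ ℚ_p⟦T⟧` have its first coefficient of norm `1` at index `n` (all earlier ones of norm `< 1`;
no hypothesis on the later ones — the comparison only sees `g_0, …, g_n`), and suppose `g(ι T) = σ·(1+T)^c·g(T)` with `σ = ±1`, `c ∈ ℤ_p`. Then
`(−1)^n = σ`. Proof: compare the coefficients of `T^n` — on the left `Σ_{d<n} g_d·[T^n]ι^d + (−1)^n g_n`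
(`[T^n]ι^d = 0` for `d > n`, `= (−1)^n` for `d = n`), on the right `σ·(g_n + Σ_{j<n} (c choose n−j)·g_j)`;
the two remainder sums have norm `< 1`, so `‖((−1)^n − σ)·g_n‖ < 1` with `g_n` a unit, and
`(−1)^n − σ ∈ {0, ±2}` with `‖2‖_p = 1` for odd `p`. [cite: MazurTateTeitelbaum1986Invent, §I.17 and §I.18]
[cite: GreenbergLNM1716, §5 p. 181 and §1 (functional equation)] -/
theorem neg_one_pow_firstUnitCoeff_eq_of_subst_invOnePlusSubOne_eq (hp2 : p ≠ 2) {g : ℚ_[p]⟦X⟧}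
    {σ : ℚ_[p]} (hσ : σ = 1 ∨ σ = -1) {c : ℤ_[p]}
    (hFE : g.subst (invOnePlusSubOne : ℚ_[p]⟦X⟧) = C σ * binomialSeries ℚ_[p] c * g)
    {n : ℕ} (hsmall : ∀ j < n, ‖coeff j g‖ < 1)
    (hunit : ‖coeff n g‖ = 1) : (-1 : ℚ_[p]) ^ n = σ := by
  have hι0 := constantCoeff_invOnePlusSubOne (R := ℚ_[p])
  set ι : ℚ_[p]⟦X⟧ := invOnePlusSubOne with hιdef
  have hp1 : (1 : ℝ) < p := by exact_mod_cast (Fact.out : p.Prime).one_lt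
  -- `‖x‖ < 1 ⇒ ‖x‖ ≤ p⁻¹`
  have hsmall' : ∀ j < n, ‖coeff j g‖ ≤ (p : ℝ)⁻¹ := by
    intro j hj
    have h := (Padic.norm_lt_pow_iff_norm_le_pow_sub_one (coeff j g) 0).mp
      (by rw [zpow_zero]; exact hsmall j hj)
    rwa [zero_sub, zpow_neg, zpow_one] at h
  have hpinv : (p : ℝ)⁻¹ < 1 := inv_lt_one_of_one_lt₀ hp1
  have hpinv0 : 0 ≤ (p : ℝ)⁻¹ := by positivity
  -- the left-hand coefficient of `T^n`
  set RA : ℚ_[p] := ∑ d ∈ Finset.range n, coeff d g * coeff n (ι ^ d) with hRA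
  have hA : coeff n (g.subst ι) = RA + coeff n g * (-1) ^ n := by
    rw [coeff_subst' (HasSubst.of_constantCoeff_zero' hι0),
      finsum_eq_sum_of_support_subset _ (s := Finset.range (n + 1)) ?_]
    · simp only [smul_eq_mul]
      rw [Finset.sum_range_succ, coeff_pow_self_of_constantCoeff_eq_zero hι0, hιdef,
        coeff_one_invOnePlusSubOne]
    · intro d hd
      simp only [Function.mem_support, ne_eq, Finset.coe_range, Set.mem_Iio] at hd ⊢
      by_contra hlt
      apply hd
      rw [coeff_of_lt_order n (lt_of_lt_of_le (by exact_mod_cast (by omega : n < d))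
        (natCast_le_order_pow hι0 d)), smul_zero]
  have hRAle : ‖RA‖ ≤ (p : ℝ)⁻¹ := by
    refine IsUltrametricDist.norm_sum_le_of_forall_le_of_nonneg hpinv0 fun d hd ↦ ?_
    rw [norm_mul]
    calc _ ≤ (p : ℝ)⁻¹ * 1 := mul_le_mul (hsmall' d (Finset.mem_range.mp hd))
          (norm_coeff_invOnePlusSubOne_pow_le_one d _) (norm_nonneg _) hpinv0
      _ = (p : ℝ)⁻¹ := mul_one _
  -- the right-hand coefficient of `T^n`
  set RB : ℚ_[p] := ∑ i ∈ Finset.range n,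
    (Ring.choose c (i + 1) • (1 : ℚ_[p])) * coeff (n - (i + 1)) g with hRB
  have hB : coeff n (C σ * binomialSeries ℚ_[p] c * g) = σ * (RB + coeff n g) := by
    rw [mul_assoc, coeff_C_mul, coeff_mul, Finset.Nat.sum_antidiagonal_eq_sum_range_succ_mk,
      Finset.sum_range_succ']
    congr 1
    simp only [binomialSeries_coeff, Ring.choose_zero_right, one_smul, Nat.sub_zero, one_mul]
    rfl
  have hRBle : ‖RB‖ ≤ (p : ℝ)⁻¹ := by
    refine IsUltrametricDist.norm_sum_le_of_forall_le_of_nonneg hpinv0 fun i hi ↦ ?_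
    have hi' : n - (i + 1) < n := by
      have := Finset.mem_range.mp hi
      omega
    have hci : ‖Ring.choose c (i + 1) • (1 : ℚ_[p])‖ ≤ 1 := by
      have h := norm_coeff_binomialSeries_le p c (i + 1)
      rwa [binomialSeries_coeff] at h
    rw [norm_mul]
    calc _ ≤ 1 * (p : ℝ)⁻¹ := mul_le_mul hci (hsmall' _ hi') (norm_nonneg _) zero_le_one
      _ = (p : ℝ)⁻¹ := one_mul _
  -- compare
  have hAB : coeff n (g.subst ι) = coeff n (C σ * binomialSeries ℚ_[p] c * g) := by
    rw [hιdef, hFE]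
  have key : ((-1 : ℚ_[p]) ^ n - σ) * coeff n g = σ * RB - RA := by
    linear_combination hAB - hA + hB
  have hσn : ‖σ‖ = 1 := by rcases hσ with h | h <;> rw [h] <;> simp
  have hkey : ‖((-1 : ℚ_[p]) ^ n - σ) * coeff n g‖ < 1 := by
    rw [key, sub_eq_add_neg]
    refine lt_of_le_of_lt ((Padic.nonarchimedean _ _).trans (max_le ?_ ?_)) hpinv
    · rw [norm_mul, hσn, one_mul]; exact hRBle
    · rw [norm_neg]; exact hRAle
  rw [norm_mul, hunit, mul_one] at hkey
  -- `(−1)^n − σ ∈ {0, ±2}` and `‖2‖_p = 1`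
  have h2 : ‖(2 : ℚ_[p])‖ = 1 := by
    have h := Padic.norm_int_le_one (p := p) 2
    have hlt : ¬ ‖((2 : ℤ) : ℚ_[p])‖ < 1 := by
      rw [Padic.norm_intCast_lt_one_iff]
      intro hd
      have := (Nat.prime_dvd_prime_iff_eq (Fact.out : p.Prime) Nat.prime_two).mp (by exact_mod_cast hd)
      exact hp2 this
    push_cast at h hlt
    exact le_antisymm h (not_lt.mp hlt)
  rcases Nat.even_or_odd n with hn | hn
  · rw [hn.neg_one_pow] at hkey ⊢
    rcases hσ with h | h
    · exact h.symm
    · exfalso; rw [h, sub_neg_eq_add, one_add_one_eq_two, h2] at hkey; exact lt_irrefl _ hkey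
  · rw [hn.neg_one_pow] at hkey ⊢
    rcases hσ with h | h
    · exfalso
      rw [h, show (-1 : ℚ_[p]) - 1 = -2 by norm_num, norm_neg, h2] at hkey
      exact lt_irrefl _ hkey
    · exact h.symm

/-! ### §3 THE Mazur–Tate–Teitelbaum function of an elliptic curve at an odd `p ‖ N` -/

variable {W : WeierstrassCurve ℚ}

/-- **λ-PARITY at a SPLIT odd multiplicative prime: `(−1)^n = σ`.** Let `E = W/ℚ` have split
multiplicative reduction at an odd `p`, newform `f ∈ S₂(Γ₀(N))`, `N = pM` with `p ∤ M`, Atkin–Lehner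
sign `w_M f = −σ f` (`σ = ±1`; for the newform of `E`, `σ = −w_E`), and let `L` be THE `p`-adic
`L`-function of the pair (`IsSplitMultPAdicLFunctionOf f p L`). For any scalar `t ∈ ℚ_p`, if `n` is the index of
the first UNIT coefficient of `t·L` (all earlier ones of norm `< 1`; for `t = p^{−μ}` this is
`λ(L)`), then `(−1)^n = σ`. In analytic rank `0` (`w_E = 1`, `σ = −1`):
`λ` is ODD (and `≥ 1`: the trivial zero). [cite: MazurTateTeitelbaum1986Invent, §I.17 and §I.18]
[cite: GreenbergLNM1716, §1 pp. 67–68, §5 p. 181] [cite: Knapp1993, Thm. 9.27(b)] -/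
theorem neg_one_pow_firstUnitCoeff_eq_sign_of_isSplitMultPAdicLFunctionOf (hp2 : p ≠ 2)
    {N : ℕ} [NeZero N] {f : CuspForm (Gamma0 N) 2}
    (hsp : W.HasSplitMultiplicativeReductionAtPrime p) (hf : IsNewformOf W f)
    {M : ℕ} [NeZero M] (hNM : N = p * M) (hpM : ¬ p ∣ M) {σ : ℤ} (hσ : σ ^ 2 = 1)
    (hW : atkinLehnerInvolution N 2 M f = (-(σ : ℂ)) • f)
    {L : PowerSeries ℚ_[p]} (hL : IsSplitMultPAdicLFunctionOf f p L) (t : ℚ_[p]) {n : ℕ}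
    (hsmall : ∀ j < n, ‖coeff j (C t * L)‖ < 1) (hunit : ‖coeff n (C t * L)‖ = 1) :
    (-1 : ℤ) ^ n = σ := by
  obtain ⟨ηM, c, hc⟩ := exists_teichmuller_exponent_natCast p hpM
  have hFE := hL.subst_eq_of_atkinLehner hsp hf hNM hpM hσ hW hc
    one_add_X_mul_invOnePlusSubOne_add_one
  have hFEg : (C t * L).subst (invOnePlusSubOne : ℚ_[p]⟦X⟧) =
      C (((σ : ℤ) : ℚ_[p])) * binomialSeries ℚ_[p] c * (C t * L) := by
    rw [← smul_eq_C_mul, subst_smul hasSubst_invOnePlusSubOne t L, hFE, smul_eq_C_mul,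
      smul_eq_C_mul]
    ring
  have hσ' : ((σ : ℤ) : ℚ_[p]) = 1 ∨ ((σ : ℤ) : ℚ_[p]) = -1 := by
    rcases sq_eq_one_iff.mp hσ with h | h <;> simp [h]
  have h := neg_one_pow_firstUnitCoeff_eq_of_subst_invOnePlusSubOne_eq hp2 hσ' hFEg hsmall hunit
  rcases sq_eq_one_iff.mp hσ with hs | hs <;> subst hs
  · rcases Nat.even_or_odd n with hn | hn
    · exact hn.neg_one_pow
    · exfalso; rw [hn.neg_one_pow] at h; norm_num at h
  · rcases Nat.even_or_odd n with hn | hn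
    · exfalso; rw [hn.neg_one_pow] at h; norm_num at h
    · exact hn.neg_one_pow

/-- **λ-PARITY at a NON-SPLIT odd multiplicative prime: `(−1)^n = σ`** — as the split statement, for
THE non-split function `IsMultPAdicLFunctionOf f p (−1) L` (MTT §I.10, `α = a_p = −1`; no trivial zero);
for the newform of `E`, `σ = w_E`, so in analytic rank `0` `λ` is EVEN.
[cite: MazurTateTeitelbaum1986Invent, §I.17 and §I.18] [cite: GreenbergLNM1716, §1 pp. 67–68, §5 p. 181]
[cite: Knapp1993, Thm. 9.27(b)] -/
theorem neg_one_pow_firstUnitCoeff_eq_sign_of_isMultPAdicLFunctionOf_neg_one (hp2 : p ≠ 2)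
    {N : ℕ} [NeZero N] {f : CuspForm (Gamma0 N) 2} (hf : IsNewformOf W f)
    (hmult : W.HasMultiplicativeReductionAtPrime p) (hns : ¬ W.HasSplitMultiplicativeReductionAtPrime p)
    {M : ℕ} [NeZero M] (hNM : N = p * M) (hpM : ¬ p ∣ M) {σ : ℤ} (hσ : σ ^ 2 = 1)
    (hW : atkinLehnerInvolution N 2 M f = (-(σ : ℂ)) • f)
    {L : PowerSeries ℚ_[p]} (hL : IsMultPAdicLFunctionOf f p (-1) L) (t : ℚ_[p]) {n : ℕ}
    (hsmall : ∀ j < n, ‖coeff j (C t * L)‖ < 1) (hunit : ‖coeff n (C t * L)‖ = 1) :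
    (-1 : ℤ) ^ n = σ := by
  obtain ⟨ηM, c, hc⟩ := exists_teichmuller_exponent_natCast p hpM
  have hFE := hL.subst_eq_of_atkinLehner hf hmult hns hNM hpM hσ hW hc
    one_add_X_mul_invOnePlusSubOne_add_one
  have hFEg : (C t * L).subst (invOnePlusSubOne : ℚ_[p]⟦X⟧) =
      C (((σ : ℤ) : ℚ_[p])) * binomialSeries ℚ_[p] c * (C t * L) := by
    rw [← smul_eq_C_mul, subst_smul hasSubst_invOnePlusSubOne t L, hFE, smul_eq_C_mul,
      smul_eq_C_mul]
    ring
  have hσ' : ((σ : ℤ) : ℚ_[p]) = 1 ∨ ((σ : ℤ) : ℚ_[p]) = -1 := by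
    rcases sq_eq_one_iff.mp hσ with h | h <;> simp [h]
  have h := neg_one_pow_firstUnitCoeff_eq_of_subst_invOnePlusSubOne_eq hp2 hσ' hFEg hsmall hunit
  rcases sq_eq_one_iff.mp hσ with hs | hs <;> subst hs
  · rcases Nat.even_or_odd n with hn | hn
    · exact hn.neg_one_pow
    · exfalso; rw [hn.neg_one_pow] at h; norm_num at h
  · rcases Nat.even_or_odd n with hn | hn
    · exfalso; rw [hn.neg_one_pow] at h; norm_num at h
    · exact hn.neg_one_pow

end Summit.BirchSwinnertonDyer.Rank1Residual.X11a.LambdaParity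

end
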